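import Summits.RiemannHypothesis.RiemannHypothesis.Theses.WeilWindowFlow
import Summits.RiemannHypothesis.RiemannHypothesis.Theorems.WeilRouteProps.WeilWindowFlow

/-!
# `Iff.rfl` bridges: Theses-free copies ↔ route propositions (route `WeilWindowFlow`)

LEAF module (imports the route file; nothing imports this): for every statement item `X` of route `WeilWindowFlow` the copy
`Summit.RiemannHypothesis.RiemannHypothesis.Theorems.WeilRouteProps.WeilWindowFlow.X` and the route declaration
`Summit.RiemannHypothesis.RiemannHypothesis.Theses.WeilWindowFlow.X` are the same proposition, by `Iff.rfl` (definitional unfolding).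
If a route statement is ever restated, this file stops elaborating — the signal to re-sync the copy. Build refactor
(21-frontier 2026-08-26T18:52:29Z); nothing here bears on the truth of RH.
-/

namespace Summit.RiemannHypothesis.RiemannHypothesis.Theorems.WeilRouteProps.WeilWindowFlow

/-- The Theses-free copy `WeilRouteProps.WeilWindowFlow.GronwallLeakage` IS the route proposition `Theses.WeilWindowFlow.GronwallLeakage` (item stmt-RiemannHypothesis-1037):
definitional unfolding (`Iff.rfl`). -/
theorem GronwallLeakage_iff :
    GronwallLeakage ↔ Summit.RiemannHypothesis.RiemannHypothesis.Theses.WeilWindowFlow.GronwallLeakage :=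
  Iff.rfl

/-- The Theses-free copy `WeilRouteProps.WeilWindowFlow.DiniLeakage` IS the route proposition `Theses.WeilWindowFlow.DiniLeakage` (item stmt-RiemannHypothesis-1038):
definitional unfolding (`Iff.rfl`). -/
theorem DiniLeakage_iff :
    DiniLeakage ↔ Summit.RiemannHypothesis.RiemannHypothesis.Theses.WeilWindowFlow.DiniLeakage :=
  Iff.rfl

/-- The Theses-free copy `WeilRouteProps.WeilWindowFlow.WindowLipschitz` IS the route proposition `Theses.WeilWindowFlow.WindowLipschitz` (item stmt-RiemannHypothesis-1039):
definitional unfolding (`Iff.rfl`). -/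
theorem WindowLipschitz_iff :
    WindowLipschitz ↔ Summit.RiemannHypothesis.RiemannHypothesis.Theses.WeilWindowFlow.WindowLipschitz :=
  Iff.rfl

/-- The Theses-free copy `WeilRouteProps.WeilWindowFlow.DerivLeakage` IS the route proposition `Theses.WeilWindowFlow.DerivLeakage` (item stmt-RiemannHypothesis-14754):
definitional unfolding (`Iff.rfl`). -/
theorem DerivLeakage_iff :
    DerivLeakage ↔ Summit.RiemannHypothesis.RiemannHypothesis.Theses.WeilWindowFlow.DerivLeakage :=
  Iff.rfl

/-- The Theses-free copy `WeilRouteProps.WeilWindowFlow.PrimeTwoWindow` IS the route proposition `Theses.WeilWindowFlow.PrimeTwoWindow` (item stmt-RiemannHypothesis-1040):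
definitional unfolding (`Iff.rfl`). -/
theorem PrimeTwoWindow_iff :
    PrimeTwoWindow ↔ Summit.RiemannHypothesis.RiemannHypothesis.Theses.WeilWindowFlow.PrimeTwoWindow :=
  Iff.rfl

/-- The Theses-free copy `WeilRouteProps.WeilWindowFlow.WindowContinuity` IS the route proposition `Theses.WeilWindowFlow.WindowContinuity` (item stmt-RiemannHypothesis-1041):
definitional unfolding (`Iff.rfl`). -/
theorem WindowContinuity_iff :
    WindowContinuity ↔ Summit.RiemannHypothesis.RiemannHypothesis.Theses.WeilWindowFlow.WindowContinuity :=
  Iff.rfl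

/-- The Theses-free copy `WeilRouteProps.WeilWindowFlow.StrictArchimedeanBottom` IS the route proposition `Theses.WeilWindowFlow.StrictArchimedeanBottom` (item stmt-RiemannHypothesis-1042):
definitional unfolding (`Iff.rfl`). -/
theorem StrictArchimedeanBottom_iff :
    StrictArchimedeanBottom ↔ Summit.RiemannHypothesis.RiemannHypothesis.Theses.WeilWindowFlow.StrictArchimedeanBottom :=
  Iff.rfl

/-- The Theses-free copy `WeilRouteProps.WeilWindowFlow.StrictUnderRH` IS the route proposition `Theses.WeilWindowFlow.StrictUnderRH` (item stmt-RiemannHypothesis-1043):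
definitional unfolding (`Iff.rfl`). -/
theorem StrictUnderRH_iff :
    StrictUnderRH ↔ Summit.RiemannHypothesis.RiemannHypothesis.Theses.WeilWindowFlow.StrictUnderRH :=
  Iff.rfl

/-- The Theses-free copy `WeilRouteProps.WeilWindowFlow.DiniGlue` IS the route proposition `Theses.WeilWindowFlow.DiniGlue` (item stmt-RiemannHypothesis-1044):
definitional unfolding (`Iff.rfl`). -/
theorem DiniGlue_iff :
    DiniGlue ↔ Summit.RiemannHypothesis.RiemannHypothesis.Theses.WeilWindowFlow.DiniGlue :=
  Iff.rfl

/-- The Theses-free copy `WeilRouteProps.WeilWindowFlow.LipschitzDerivGlue` IS the route proposition `Theses.WeilWindowFlow.LipschitzDerivGlue` (item stmt-RiemannHypothesis-14755):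
definitional unfolding (`Iff.rfl`). -/
theorem LipschitzDerivGlue_iff :
    LipschitzDerivGlue ↔ Summit.RiemannHypothesis.RiemannHypothesis.Theses.WeilWindowFlow.LipschitzDerivGlue :=
  Iff.rfl

/-- The Theses-free copy `WeilRouteProps.WeilWindowFlow.Assembly` IS the route proposition `Theses.WeilWindowFlow.Assembly` (item stmt-RiemannHypothesis-1045):
definitional unfolding (`Iff.rfl`). -/
theorem Assembly_iff :
    Assembly ↔ Summit.RiemannHypothesis.RiemannHypothesis.Theses.WeilWindowFlow.Assembly :=
  Iff.rfl

end Summit.RiemannHypothesis.RiemannHypothesis.Theorems.WeilRouteProps.WeilWindowFlow
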